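import Summits.Parity.GeneralizedHardyLittlewood.Theorems.PrimeLevelFamEdgeMomentsBeyondDiagonalDiagDecorOrderTwoTwoAssembly
import Summits.Parity.GeneralizedHardyLittlewood.Theorems.PrimeLevelFamEdgeMomentsBeyondDiagonalDiagRungOne
import Summits.Parity.GeneralizedHardyLittlewood.Theorems.PrimeLevelFamEdgeMomentsBeyondDiagonalDiagOrderSymm
import HarnessLib

/-!
# Route `PrimeLevelFamEdge`, crux K_A `MomentsBeyondDiagonal` (stmt-Parity-20007), line «petersson_layers» v4, stub `stub_diag`:
# **RUNG `N = 2` OF THE GRADED ASSEMBLY, CLOSED MODULO ITS THREE REMAINING ANALYTIC INPUTS (R₀₂), (Poly₂₂), (R₂₂):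
# the diagonal main term for every `Q` of degree `≤ 2`**

Rung `N` of `…DiagRungOne.diagPart_asymp_of_selbergOrderAsymptotics_le` needs the per-order targets with `i, j ≤ N`, `i + j`
even, `(i,j) ≠ (0,0)`. Rung 1 is unconditional (`…DiagRungOne`, p827844: order `(1,1)` = `…DiagRemEstimate.orderOneOne_target`).
Rung 2 adds the orders `(0,2)`, `(2,0)`, `(2,2)`:
* `(0,2)` ⟸ (R₀₂) by `…DiagDecorOrderZeroTwoAssembly.orderZeroTwo_target_of_remainder` (p827655);
* `(2,0)` ⟸ `(0,2)` by the order symmetry `…DiagOrderSymm.selbergOrder_symm` (p827457) — done here;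
* `(2,2)` ⟸ (Poly₂₂) + (R₂₂) by `…DiagDecorOrderTwoTwoAssembly.orderTwoTwo_target_of_poly_of_remainder` (this generation).

* `diagPart_asymp_of_natDegree_le_two_of_remainders` — **(R₀₂) → (Poly₂₂) → (R₂₂) → for every admissible `P`, every `Q`
  with `deg Q ≤ 2` and every `Δ' ∈ (1, Δ]`, `Δ ≤ 3/2`:
  `‖diagPart q P Q Δ' − 2ζ(2)² q̂/(Δ'²ℓ²)·(Q₀²·secondMomentForm Δ' P 1 + 2Q₁²τ₁₁ + 4Q₀Q₂τ₀₂ + 2Q₂²τ₂₂)‖ ≤ C q̂ ℓ⁻³`**,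
  `τ₁₁`, `τ₀₂` the closed forms of `…DiagRungOne` / `…DiagDecorOrderZeroTwoAssembly`, `τ₂₂ = Δ′⁴𝔎(1/Δ′,P)/(2(π²/6)²)` with
  `𝔎` the level-free functional of (Poly₂₂).

The three hypotheses are stated VERBATIM as in the files that consume them, so that landing (R₀₂) (lineage famedge-1), the
`M₄`-engine behind (Poly₂₂) and (R₂₂) makes rung 2 unconditional by three `exact`s. Def-free; helper `--supports stmt-Parity-20007`;
closes nothing (`stub_diag` needs every rung; `stub_rung/core/band/identP` untouched); K_A, K_B and the Parity summit are NOT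
proved; nothing about Landau–Siegel zeros.

## References
* E. Kowalski, P. Michel, J. VanderKam, J. reine angew. Math. 526 (2000), (23)–(28) pp. 13–15, Prop. 5.1 (31) p. 18.
  [cite: KowalskiMichelVanderKam2000, (23)–(28) pp. 13–15 — derivation (diagonal main term, Q of degree ≤ 2)]
-/

noncomputable section

open scoped Real ArithmeticFunction.Moebius
open Complex MeasureTheory Polynomial Finset ArithmeticFunction Set
open Literature.NumberTheory.LFunctions Literature.NumberTheory.LFunctions.KMV2000

namespace Summit.Parity.GeneralizedHardyLittlewood.Theorems.MomentsBeyondDiagonal.DiagLines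

open Summit.Parity.GeneralizedHardyLittlewood.Theorems.PrimeLevelFamEdgeIdeaDeltas.PeterssonLayers
  (diagPart HasShape SubOf SubDiag)
open Summit.Parity.GeneralizedHardyLittlewood.Theorems.MomentsBeyondDiagonal.DiagCorner (orderOneOne_target)
open Summit.Parity.GeneralizedHardyLittlewood.Theorems.MomentsBeyondDiagonal.DiagKernel
  (orderZeroTwo_target_of_remainder orderTwoTwo_target_of_poly_of_remainder)

set_option maxHeartbeats 800000 in
-- large statement (three verbatim analytic hypotheses, four closed-form functionals)
/-- **RUNG `N = 2` MODULO (R₀₂), (Poly₂₂), (R₂₂)** (see the module docstring; `Δ ≤ 3/2`, `deg Q ≤ 2`).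
[cite: KowalskiMichelVanderKam2000, (23)–(28) pp. 13–15, Prop. 5.1 (31) — derivation (diagonal main term, Q of degree ≤ 2)] -/
theorem diagPart_asymp_of_natDegree_le_two_of_remainders {Δ : ℝ} (hΔ : Δ ≤ 3 / 2) (𝔎 : ℝ → ℝ[X] → ℝ)
    (hR₀₂ : ∃ E₀₀ E₀₁ E₀₂ μ₂ : ℝ, ∀ P : ℝ[X], KMV2000.Admissible P → ∀ Δ' : ℝ, 1 < Δ' → Δ' ≤ Δ →
      ∃ C : ℝ, ∃ q₀ : ℕ, ∀ (q : ℕ) [NeZero q], q₀ ≤ q →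
        |∑ c ∈ Icc 1 ⌊qhat q ^ Δ'⌋₊, ∑ g ∈ Icc 1 (⌊qhat q ^ Δ'⌋₊ / c), (μ g : ℝ) * c *
        ∑ k₁ ∈ Icc 1 (⌊qhat q ^ Δ'⌋₊ / (c * g)), ∑ k₂ ∈ Icc 1 (⌊qhat q ^ Δ'⌋₊ / (c * g)),
          ((μ (c * g * k₁) : ℝ) * ((psi (c * g * k₁))⁻¹ *
              P.eval (Real.log (qhat q ^ Δ' / ((c * g * k₁ : ℕ) : ℝ)) / Real.log (qhat q ^ Δ'))) / ((c * g * k₁ : ℕ) : ℝ)) *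
            ((μ (c * g * k₂) : ℝ) * ((psi (c * g * k₂))⁻¹ *
              P.eval (Real.log (qhat q ^ Δ' / ((c * g * k₂ : ℕ) : ℝ)) / Real.log (qhat q ^ Δ'))) / ((c * g * k₂ : ℕ) : ℝ)) *
            ((k₁.divisors.card : ℝ) * (k₂.divisors.card : ℝ) *
              (((2 * (Real.log (qhat q) - Real.log g) - Real.log k₁ - Real.log k₂) ^ 2 +
                  ((∑ p ∈ k₁.primeFactors, Real.log p ^ 2) + ∑ p ∈ k₂.primeFactors, Real.log p ^ 2)) / 4 *
                ((∫ u₁ in Ioi (0 : ℝ), ∫ u₂ in Ioi ((((g * g * (k₁ * k₂) : ℕ) : ℝ) / qhat q ^ 2) / u₁),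
              Real.exp (-(u₁ + u₂)) / (1 - Real.exp (-(u₁ + u₂))) ^ 2) -
                  (Real.log (qhat q ^ 2 / ((g * g * (k₁ * k₂) : ℕ) : ℝ)) / 2 + E₀₀)) +
              (2 * (Real.log (qhat q) - Real.log g) - Real.log k₁ - Real.log k₂) *
                ((∫ u₁ in Ioi (0 : ℝ), ∫ u₂ in Ioi ((((g * g * (k₁ * k₂) : ℕ) : ℝ) / qhat q ^ 2) / u₁),
              Real.exp (-(u₁ + u₂)) / (1 - Real.exp (-(u₁ + u₂))) ^ 2 * Real.log u₂) -
                  (-(Real.log (qhat q ^ 2 / ((g * g * (k₁ * k₂) : ℕ) : ℝ)) ^ 2) / 8 + E₀₁)) +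
              ((∫ u₁ in Ioi (0 : ℝ), ∫ u₂ in Ioi ((((g * g * (k₁ * k₂) : ℕ) : ℝ) / qhat q ^ 2) / u₁),
              Real.exp (-(u₁ + u₂)) / (1 - Real.exp (-(u₁ + u₂))) ^ 2 * Real.log u₂ ^ 2) -
                (Real.log (qhat q ^ 2 / ((g * g * (k₁ * k₂) : ℕ) : ℝ)) ^ 3 / 24 + 2 * μ₂ * Real.log (qhat q ^ 2 / ((g * g * (k₁ * k₂) : ℕ) : ℝ)) + E₀₂))))| ≤
          C / Real.log (qhat q))
    (hPoly : ∀ P : ℝ[X], P.coeff 0 = 0 → P.coeff 1 = 0 → ∀ lam : ℝ, 0 ≤ lam → lam ≤ 1 →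
      ∀ E₀₀ E₀₁ E₁₀ E₀₂ E₂₀ E₁₁ E₁₂ E₂₁ E₂₂ μ₂ μ₄ : ℝ, ∃ C : ℝ, ∀ M : ℝ, 3 ≤ M →
      |∑ c ∈ Icc 1 ⌊M⌋₊, ∑ g ∈ Icc 1 (⌊M⌋₊ / c), (μ g : ℝ) * c *
        ∑ k₁ ∈ Icc 1 (⌊M⌋₊ / (c * g)), ∑ k₂ ∈ Icc 1 (⌊M⌋₊ / (c * g)),
          ((μ (c * g * k₁) : ℝ) * ((psi (c * g * k₁))⁻¹ *
              P.eval (Real.log (M / ((c * g * k₁ : ℕ) : ℝ)) / Real.log M)) / ((c * g * k₁ : ℕ) : ℝ)) *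
            ((μ (c * g * k₂) : ℝ) * ((psi (c * g * k₂))⁻¹ *
              P.eval (Real.log (M / ((c * g * k₂ : ℕ) : ℝ)) / Real.log M)) / ((c * g * k₂ : ℕ) : ℝ)) *
            (1 / 160 * ((k₁.divisors.card : ℝ) * (k₂.divisors.card : ℝ) *
                (2 * (lam * Real.log M) - 2 * Real.log g - Real.log k₁ - Real.log k₂) ^ 5) +
              E₀₀ / 16 * ((k₁.divisors.card : ℝ) * (k₂.divisors.card : ℝ) *
                (2 * (lam * Real.log M) - 2 * Real.log g - Real.log k₁ - Real.log k₂) ^ 4) +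
              ((E₀₁ + E₁₀) / 4 - μ₂ / 3) * ((k₁.divisors.card : ℝ) * (k₂.divisors.card : ℝ) *
                (2 * (lam * Real.log M) - 2 * Real.log g - Real.log k₁ - Real.log k₂) ^ 3) +
              ((E₀₂ + E₂₀) / 4 + E₁₁) * ((k₁.divisors.card : ℝ) * (k₂.divisors.card : ℝ) *
                (2 * (lam * Real.log M) - 2 * Real.log g - Real.log k₁ - Real.log k₂) ^ 2) +
              (2 * μ₄ + E₁₂ + E₂₁) * ((k₁.divisors.card : ℝ) * (k₂.divisors.card : ℝ) *
                (2 * (lam * Real.log M) - 2 * Real.log g - Real.log k₁ - Real.log k₂) ^ 1) +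
              E₂₂ * ((k₁.divisors.card : ℝ) * (k₂.divisors.card : ℝ) *
                (2 * (lam * Real.log M) - 2 * Real.log g - Real.log k₁ - Real.log k₂) ^ 0) +
              (-1 / 48) * ((k₁.divisors.card : ℝ) * (∑ p ∈ k₁.primeFactors, Real.log p ^ 2) * (k₂.divisors.card : ℝ) *
                (2 * (lam * Real.log M) - 2 * Real.log g - Real.log k₁ - Real.log k₂) ^ 3) +
              (-1 / 48) * ((k₁.divisors.card : ℝ) * ((k₂.divisors.card : ℝ) * ∑ p ∈ k₂.primeFactors, Real.log p ^ 2) *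
                (2 * (lam * Real.log M) - 2 * Real.log g - Real.log k₁ - Real.log k₂) ^ 3) +
              (-E₀₀ / 8) * ((k₁.divisors.card : ℝ) * (∑ p ∈ k₁.primeFactors, Real.log p ^ 2) * (k₂.divisors.card : ℝ) *
                (2 * (lam * Real.log M) - 2 * Real.log g - Real.log k₁ - Real.log k₂) ^ 2) +
              (-E₀₀ / 8) * ((k₁.divisors.card : ℝ) * ((k₂.divisors.card : ℝ) * ∑ p ∈ k₂.primeFactors, Real.log p ^ 2) *
                (2 * (lam * Real.log M) - 2 * Real.log g - Real.log k₁ - Real.log k₂) ^ 2) +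
              (3 * μ₂ - (E₀₁ + E₁₀) / 4) * ((k₁.divisors.card : ℝ) * (∑ p ∈ k₁.primeFactors, Real.log p ^ 2) * (k₂.divisors.card : ℝ) *
                (2 * (lam * Real.log M) - 2 * Real.log g - Real.log k₁ - Real.log k₂) ^ 1) +
              (3 * μ₂ - (E₀₁ + E₁₀) / 4) * ((k₁.divisors.card : ℝ) * ((k₂.divisors.card : ℝ) * ∑ p ∈ k₂.primeFactors, Real.log p ^ 2) *
                (2 * (lam * Real.log M) - 2 * Real.log g - Real.log k₁ - Real.log k₂) ^ 1) +
              ((E₀₂ + E₂₀) / 4 - E₁₁) * ((k₁.divisors.card : ℝ) * (∑ p ∈ k₁.primeFactors, Real.log p ^ 2) * (k₂.divisors.card : ℝ) *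
                (2 * (lam * Real.log M) - 2 * Real.log g - Real.log k₁ - Real.log k₂) ^ 0) +
              ((E₀₂ + E₂₀) / 4 - E₁₁) * ((k₁.divisors.card : ℝ) * ((k₂.divisors.card : ℝ) * ∑ p ∈ k₂.primeFactors, Real.log p ^ 2) *
                (2 * (lam * Real.log M) - 2 * Real.log g - Real.log k₁ - Real.log k₂) ^ 0) +
              3 / 16 * ((k₁.divisors.card : ℝ) * (∑ p ∈ k₁.primeFactors, Real.log p ^ 2) *
                ((k₂.divisors.card : ℝ) * (∑ p ∈ k₂.primeFactors, Real.log p ^ 2)) *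
                (2 * (lam * Real.log M) - 2 * Real.log g - Real.log k₁ - Real.log k₂) ^ 1) +
              3 * E₀₀ / 8 * ((k₁.divisors.card : ℝ) * (∑ p ∈ k₁.primeFactors, Real.log p ^ 2) *
                ((k₂.divisors.card : ℝ) * (∑ p ∈ k₂.primeFactors, Real.log p ^ 2)) *
                (2 * (lam * Real.log M) - 2 * Real.log g - Real.log k₁ - Real.log k₂) ^ 0) +
              1 / 32 * ((k₁.divisors.card : ℝ) * (3 * (∑ p ∈ k₁.primeFactors, Real.log p ^ 2) ^ 2 - 2 * ∑ p ∈ k₁.primeFactors, Real.log p ^ 4) *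
                (k₂.divisors.card : ℝ) * (2 * (lam * Real.log M) - 2 * Real.log g - Real.log k₁ - Real.log k₂) ^ 1) +
              1 / 32 * ((k₁.divisors.card : ℝ) * ((k₂.divisors.card : ℝ) *
                (3 * (∑ p ∈ k₂.primeFactors, Real.log p ^ 2) ^ 2 - 2 * ∑ p ∈ k₂.primeFactors, Real.log p ^ 4)) *
                (2 * (lam * Real.log M) - 2 * Real.log g - Real.log k₁ - Real.log k₂) ^ 1) +
              E₀₀ / 16 * ((k₁.divisors.card : ℝ) * (3 * (∑ p ∈ k₁.primeFactors, Real.log p ^ 2) ^ 2 - 2 * ∑ p ∈ k₁.primeFactors, Real.log p ^ 4) *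
                (k₂.divisors.card : ℝ) * (2 * (lam * Real.log M) - 2 * Real.log g - Real.log k₁ - Real.log k₂) ^ 0) +
              E₀₀ / 16 * ((k₁.divisors.card : ℝ) * ((k₂.divisors.card : ℝ) *
                (3 * (∑ p ∈ k₂.primeFactors, Real.log p ^ 2) ^ 2 - 2 * ∑ p ∈ k₂.primeFactors, Real.log p ^ 4)) *
                (2 * (lam * Real.log M) - 2 * Real.log g - Real.log k₁ - Real.log k₂) ^ 0)) -
        𝔎 lam P * Real.log M ^ 2| ≤ C * Real.log M)
    (hR₂₂ : ∃ E₀₀ E₀₁ E₁₀ E₀₂ E₂₀ E₁₁ E₁₂ E₂₁ E₂₂ μ₂ μ₄ : ℝ, ∀ P : ℝ[X], KMV2000.Admissible P → ∀ Δ' : ℝ, 1 < Δ' → Δ' ≤ Δ →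
      ∃ C : ℝ, ∃ q₀ : ℕ, ∀ (q : ℕ) [NeZero q], q₀ ≤ q →
        |∑ c ∈ Icc 1 ⌊qhat q ^ Δ'⌋₊, ∑ g ∈ Icc 1 (⌊qhat q ^ Δ'⌋₊ / c), (μ g : ℝ) * c *
        ∑ k₁ ∈ Icc 1 (⌊qhat q ^ Δ'⌋₊ / (c * g)), ∑ k₂ ∈ Icc 1 (⌊qhat q ^ Δ'⌋₊ / (c * g)),
          ((μ (c * g * k₁) : ℝ) * ((psi (c * g * k₁))⁻¹ *
              P.eval (Real.log (qhat q ^ Δ' / ((c * g * k₁ : ℕ) : ℝ)) / Real.log (qhat q ^ Δ'))) / ((c * g * k₁ : ℕ) : ℝ)) *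
            ((μ (c * g * k₂) : ℝ) * ((psi (c * g * k₂))⁻¹ *
              P.eval (Real.log (qhat q ^ Δ' / ((c * g * k₂ : ℕ) : ℝ)) / Real.log (qhat q ^ Δ'))) / ((c * g * k₂ : ℕ) : ℝ)) *
            ((k₁.divisors.card : ℝ) * (k₂.divisors.card : ℝ) *
              (((2 * (Real.log (qhat q) - Real.log g) - Real.log k₁ - Real.log k₂) ^ 4 -
                    2 * (2 * (Real.log (qhat q) - Real.log g) - Real.log k₁ - Real.log k₂) ^ 2 *
                      ((∑ p ∈ k₁.primeFactors, Real.log p ^ 2) + ∑ p ∈ k₂.primeFactors, Real.log p ^ 2) +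
                    3 * ((∑ p ∈ k₁.primeFactors, Real.log p ^ 2) + ∑ p ∈ k₂.primeFactors, Real.log p ^ 2) ^ 2 -
                    2 * ((∑ p ∈ k₁.primeFactors, Real.log p ^ 4) + ∑ p ∈ k₂.primeFactors, Real.log p ^ 4)) / 16 *
                  ((∫ u₁ in Ioi (0 : ℝ), ∫ u₂ in Ioi ((((g * g * (k₁ * k₂) : ℕ) : ℝ) / qhat q ^ 2) / u₁),
              Real.exp (-(u₁ + u₂)) / (1 - Real.exp (-(u₁ + u₂))) ^ 2) -
                  (Real.log (qhat q ^ 2 / ((g * g * (k₁ * k₂) : ℕ) : ℝ)) / 2 + E₀₀)) +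
                ((2 * (Real.log (qhat q) - Real.log g) - Real.log k₁ - Real.log k₂) ^ 3 -
                    (2 * (Real.log (qhat q) - Real.log g) - Real.log k₁ - Real.log k₂) *
                      ((∑ p ∈ k₁.primeFactors, Real.log p ^ 2) + ∑ p ∈ k₂.primeFactors, Real.log p ^ 2)) / 4 *
                  (((∫ u₁ in Ioi (0 : ℝ), ∫ u₂ in Ioi ((((g * g * (k₁ * k₂) : ℕ) : ℝ) / qhat q ^ 2) / u₁),
              Real.exp (-(u₁ + u₂)) / (1 - Real.exp (-(u₁ + u₂))) ^ 2 * Real.log u₂) -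
                  (-(Real.log (qhat q ^ 2 / ((g * g * (k₁ * k₂) : ℕ) : ℝ)) ^ 2) / 8 + E₀₁)) +
                    ((∫ u₁ in Ioi (0 : ℝ), Real.log u₁ * ∫ u₂ in Ioi ((((g * g * (k₁ * k₂) : ℕ) : ℝ) / qhat q ^ 2) / u₁),
              Real.exp (-(u₁ + u₂)) / (1 - Real.exp (-(u₁ + u₂))) ^ 2) -
                  (-(Real.log (qhat q ^ 2 / ((g * g * (k₁ * k₂) : ℕ) : ℝ)) ^ 2) / 8 + E₁₀))) +
                ((2 * (Real.log (qhat q) - Real.log g) - Real.log k₁ - Real.log k₂) ^ 2 +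
                    ((∑ p ∈ k₁.primeFactors, Real.log p ^ 2) + ∑ p ∈ k₂.primeFactors, Real.log p ^ 2)) / 4 *
                  (((∫ u₁ in Ioi (0 : ℝ), ∫ u₂ in Ioi ((((g * g * (k₁ * k₂) : ℕ) : ℝ) / qhat q ^ 2) / u₁),
              Real.exp (-(u₁ + u₂)) / (1 - Real.exp (-(u₁ + u₂))) ^ 2 * Real.log u₂ ^ 2) -
                  (Real.log (qhat q ^ 2 / ((g * g * (k₁ * k₂) : ℕ) : ℝ)) ^ 3 / 24 + 2 * μ₂ * Real.log (qhat q ^ 2 / ((g * g * (k₁ * k₂) : ℕ) : ℝ)) + E₀₂)) +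
                    ((∫ u₁ in Ioi (0 : ℝ), Real.log u₁ ^ 2 * ∫ u₂ in Ioi ((((g * g * (k₁ * k₂) : ℕ) : ℝ) / qhat q ^ 2) / u₁),
              Real.exp (-(u₁ + u₂)) / (1 - Real.exp (-(u₁ + u₂))) ^ 2) -
                  (Real.log (qhat q ^ 2 / ((g * g * (k₁ * k₂) : ℕ) : ℝ)) ^ 3 / 24 + 2 * μ₂ * Real.log (qhat q ^ 2 / ((g * g * (k₁ * k₂) : ℕ) : ℝ)) + E₂₀))) +
                ((2 * (Real.log (qhat q) - Real.log g) - Real.log k₁ - Real.log k₂) ^ 2 -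
                    ((∑ p ∈ k₁.primeFactors, Real.log p ^ 2) + ∑ p ∈ k₂.primeFactors, Real.log p ^ 2)) *
                  ((∫ u₁ in Ioi (0 : ℝ), Real.log u₁ * ∫ u₂ in Ioi ((((g * g * (k₁ * k₂) : ℕ) : ℝ) / qhat q ^ 2) / u₁),
              Real.exp (-(u₁ + u₂)) / (1 - Real.exp (-(u₁ + u₂))) ^ 2 * Real.log u₂) -
                  (Real.log (qhat q ^ 2 / ((g * g * (k₁ * k₂) : ℕ) : ℝ)) ^ 3 / 24 - 2 * μ₂ * Real.log (qhat q ^ 2 / ((g * g * (k₁ * k₂) : ℕ) : ℝ)) + E₁₁)) +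
                (2 * (Real.log (qhat q) - Real.log g) - Real.log k₁ - Real.log k₂) *
                  (((∫ u₁ in Ioi (0 : ℝ), Real.log u₁ * ∫ u₂ in Ioi ((((g * g * (k₁ * k₂) : ℕ) : ℝ) / qhat q ^ 2) / u₁),
              Real.exp (-(u₁ + u₂)) / (1 - Real.exp (-(u₁ + u₂))) ^ 2 * Real.log u₂ ^ 2) -
                  (-(Real.log (qhat q ^ 2 / ((g * g * (k₁ * k₂) : ℕ) : ℝ)) ^ 4) / 64 + μ₂ / 2 * Real.log (qhat q ^ 2 / ((g * g * (k₁ * k₂) : ℕ) : ℝ)) ^ 2 + E₁₂)) +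
                    ((∫ u₁ in Ioi (0 : ℝ), Real.log u₁ ^ 2 * ∫ u₂ in Ioi ((((g * g * (k₁ * k₂) : ℕ) : ℝ) / qhat q ^ 2) / u₁),
              Real.exp (-(u₁ + u₂)) / (1 - Real.exp (-(u₁ + u₂))) ^ 2 * Real.log u₂) -
                  (-(Real.log (qhat q ^ 2 / ((g * g * (k₁ * k₂) : ℕ) : ℝ)) ^ 4) / 64 + μ₂ / 2 * Real.log (qhat q ^ 2 / ((g * g * (k₁ * k₂) : ℕ) : ℝ)) ^ 2 + E₂₁))) +
                ((∫ u₁ in Ioi (0 : ℝ), Real.log u₁ ^ 2 * ∫ u₂ in Ioi ((((g * g * (k₁ * k₂) : ℕ) : ℝ) / qhat q ^ 2) / u₁),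
              Real.exp (-(u₁ + u₂)) / (1 - Real.exp (-(u₁ + u₂))) ^ 2 * Real.log u₂ ^ 2) -
                  (Real.log (qhat q ^ 2 / ((g * g * (k₁ * k₂) : ℕ) : ℝ)) ^ 5 / 160 - μ₂ / 3 * Real.log (qhat q ^ 2 / ((g * g * (k₁ * k₂) : ℕ) : ℝ)) ^ 3 +
                    2 * μ₄ * Real.log (qhat q ^ 2 / ((g * g * (k₁ * k₂) : ℕ) : ℝ)) + E₂₂))))| ≤
          C * Real.log (qhat q))
    {P Q : ℝ[X]} (hP : KMV2000.Admissible P) (hQ : Q.natDegree ≤ 2) {Δ' : ℝ} (h1 : 1 < Δ') (h2 : Δ' ≤ Δ) :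
    ∃ C : ℝ, ∃ q₀ : ℕ, ∀ (q : ℕ) [NeZero q], q₀ ≤ q →
      ‖diagPart q P Q Δ' -
          ((2 * riemannZeta 2 ^ 2 *
              ((qhat q / (Δ' ^ 2 * Real.log (qhat q) ^ 2) : ℝ) : ℂ)) *
            ((Q.coeff 0 ^ 2 * KMV2000.secondMomentForm Δ' P 1 +
              2 * Q.coeff 1 ^ 2 *
                (Δ' ^ 2 * ((π ^ 2 / 6) ^ 2 *
              ((∑ j ∈ Finset.range (3 + 1), ∑ i ∈ Finset.range (j + 1),
                  ((3 : ℕ).choose j : ℝ) * (j.choose i : ℝ) * 2 ^ (3 - j) *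
                    ∫ u in (0 : ℝ)..1, (((Polynomial.C (1 / Δ') - X) ^ (3 - j) *
                      derivative (derivative (X ^ i * P))) * derivative (derivative (X ^ (j - i) * P))).eval u) / 24 -
                (∑ j ∈ Finset.range (1 + 1), ∑ i ∈ Finset.range (j + 1),
                  ((1 : ℕ).choose j : ℝ) * (j.choose i : ℝ) * 2 ^ (1 - j) *
                    ∫ u in (0 : ℝ)..1, (((Polynomial.C (1 / Δ') - X) ^ (1 - j) * (-(2 : ℝ) • (X ^ i * P))) *
                      derivative (derivative (X ^ (j - i) * P))).eval u) / 4)) / (2 * (π ^ 2 / 6) ^ 2)) +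
              4 * (Q.coeff 0 * Q.coeff 2) *
                (Δ' ^ 2 * ((π ^ 2 / 6) ^ 2 *
              ((∑ j ∈ Finset.range (3 + 1), ∑ i ∈ Finset.range (j + 1),
                  ((3 : ℕ).choose j : ℝ) * (j.choose i : ℝ) * 2 ^ (3 - j) *
                    ∫ u in (0 : ℝ)..1, (((Polynomial.C (1 / Δ') - X) ^ (3 - j) *
                      derivative (derivative (X ^ i * P))) * derivative (derivative (X ^ (j - i) * P))).eval u) / 24 +
                (∑ j ∈ Finset.range (1 + 1), ∑ i ∈ Finset.range (j + 1),
                  ((1 : ℕ).choose j : ℝ) * (j.choose i : ℝ) * 2 ^ (1 - j) *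
                    ∫ u in (0 : ℝ)..1, (((Polynomial.C (1 / Δ') - X) ^ (1 - j) * (-(2 : ℝ) • (X ^ i * P))) *
                      derivative (derivative (X ^ (j - i) * P))).eval u) / 4)) / (2 * (π ^ 2 / 6) ^ 2)) +
              2 * Q.coeff 2 ^ 2 *
                (Δ' ^ 2 * (Δ' ^ 2 * 𝔎 (1 / Δ') P) / (2 * (π ^ 2 / 6) ^ 2)) : ℝ) : ℂ))‖ ≤
        C * qhat q * (Real.log (qhat q))⁻¹ ^ 3 := by
  obtain ⟨τ, hτ⟩ : ∃ τ : ℕ → ℕ → ℝ → ℝ[X] → ℝ, τ = fun i j Δ' P ↦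
    if i = 1 ∧ j = 1 then
      (Δ' ^ 2 * ((π ^ 2 / 6) ^ 2 *
              ((∑ j ∈ Finset.range (3 + 1), ∑ i ∈ Finset.range (j + 1),
                  ((3 : ℕ).choose j : ℝ) * (j.choose i : ℝ) * 2 ^ (3 - j) *
                    ∫ u in (0 : ℝ)..1, (((Polynomial.C (1 / Δ') - X) ^ (3 - j) *
                      derivative (derivative (X ^ i * P))) * derivative (derivative (X ^ (j - i) * P))).eval u) / 24 -
                (∑ j ∈ Finset.range (1 + 1), ∑ i ∈ Finset.range (j + 1),
                  ((1 : ℕ).choose j : ℝ) * (j.choose i : ℝ) * 2 ^ (1 - j) *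
                    ∫ u in (0 : ℝ)..1, (((Polynomial.C (1 / Δ') - X) ^ (1 - j) * (-(2 : ℝ) • (X ^ i * P))) *
                      derivative (derivative (X ^ (j - i) * P))).eval u) / 4)) / (2 * (π ^ 2 / 6) ^ 2))
    else if i = 2 ∧ j = 2 then
      (Δ' ^ 2 * (Δ' ^ 2 * 𝔎 (1 / Δ') P) / (2 * (π ^ 2 / 6) ^ 2))
    else if i + j = 2 then
      (Δ' ^ 2 * ((π ^ 2 / 6) ^ 2 *
              ((∑ j ∈ Finset.range (3 + 1), ∑ i ∈ Finset.range (j + 1),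
                  ((3 : ℕ).choose j : ℝ) * (j.choose i : ℝ) * 2 ^ (3 - j) *
                    ∫ u in (0 : ℝ)..1, (((Polynomial.C (1 / Δ') - X) ^ (3 - j) *
                      derivative (derivative (X ^ i * P))) * derivative (derivative (X ^ (j - i) * P))).eval u) / 24 +
                (∑ j ∈ Finset.range (1 + 1), ∑ i ∈ Finset.range (j + 1),
                  ((1 : ℕ).choose j : ℝ) * (j.choose i : ℝ) * 2 ^ (1 - j) *
                    ∫ u in (0 : ℝ)..1, (((Polynomial.C (1 / Δ') - X) ^ (1 - j) * (-(2 : ℝ) • (X ^ i * P))) *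
                      derivative (derivative (X ^ (j - i) * P))).eval u) / 4)) / (2 * (π ^ 2 / 6) ^ 2))
    else KMV2000.secondMomentForm Δ' P 1 / 2 := ⟨_, rfl⟩
  have t00 : ∀ (Δ' : ℝ) (P : ℝ[X]), τ 0 0 Δ' P = KMV2000.secondMomentForm Δ' P 1 / 2 := fun _ _ ↦ by
    rw [hτ]; norm_num
  have t11 : ∀ (Δ' : ℝ) (P : ℝ[X]), τ 1 1 Δ' P =
      (Δ' ^ 2 * ((π ^ 2 / 6) ^ 2 *
              ((∑ j ∈ Finset.range (3 + 1), ∑ i ∈ Finset.range (j + 1),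
                  ((3 : ℕ).choose j : ℝ) * (j.choose i : ℝ) * 2 ^ (3 - j) *
                    ∫ u in (0 : ℝ)..1, (((Polynomial.C (1 / Δ') - X) ^ (3 - j) *
                      derivative (derivative (X ^ i * P))) * derivative (derivative (X ^ (j - i) * P))).eval u) / 24 -
                (∑ j ∈ Finset.range (1 + 1), ∑ i ∈ Finset.range (j + 1),
                  ((1 : ℕ).choose j : ℝ) * (j.choose i : ℝ) * 2 ^ (1 - j) *
                    ∫ u in (0 : ℝ)..1, (((Polynomial.C (1 / Δ') - X) ^ (1 - j) * (-(2 : ℝ) • (X ^ i * P))) *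
                      derivative (derivative (X ^ (j - i) * P))).eval u) / 4)) / (2 * (π ^ 2 / 6) ^ 2)) := fun _ _ ↦ by
    rw [hτ]; norm_num
  have t22 : ∀ (Δ' : ℝ) (P : ℝ[X]), τ 2 2 Δ' P =
      (Δ' ^ 2 * (Δ' ^ 2 * 𝔎 (1 / Δ') P) / (2 * (π ^ 2 / 6) ^ 2)) := fun _ _ ↦ by
    rw [hτ]; norm_num
  have t02 : ∀ (Δ' : ℝ) (P : ℝ[X]), τ 0 2 Δ' P =
      (Δ' ^ 2 * ((π ^ 2 / 6) ^ 2 *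
              ((∑ j ∈ Finset.range (3 + 1), ∑ i ∈ Finset.range (j + 1),
                  ((3 : ℕ).choose j : ℝ) * (j.choose i : ℝ) * 2 ^ (3 - j) *
                    ∫ u in (0 : ℝ)..1, (((Polynomial.C (1 / Δ') - X) ^ (3 - j) *
                      derivative (derivative (X ^ i * P))) * derivative (derivative (X ^ (j - i) * P))).eval u) / 24 +
                (∑ j ∈ Finset.range (1 + 1), ∑ i ∈ Finset.range (j + 1),
                  ((1 : ℕ).choose j : ℝ) * (j.choose i : ℝ) * 2 ^ (1 - j) *
                    ∫ u in (0 : ℝ)..1, (((Polynomial.C (1 / Δ') - X) ^ (1 - j) * (-(2 : ℝ) • (X ^ i * P))) *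
                      derivative (derivative (X ^ (j - i) * P))).eval u) / 4)) / (2 * (π ^ 2 / 6) ^ 2)) := fun _ _ ↦ by
    rw [hτ]; norm_num
  have t20 : ∀ (Δ' : ℝ) (P : ℝ[X]), τ 2 0 Δ' P =
      (Δ' ^ 2 * ((π ^ 2 / 6) ^ 2 *
              ((∑ j ∈ Finset.range (3 + 1), ∑ i ∈ Finset.range (j + 1),
                  ((3 : ℕ).choose j : ℝ) * (j.choose i : ℝ) * 2 ^ (3 - j) *
                    ∫ u in (0 : ℝ)..1, (((Polynomial.C (1 / Δ') - X) ^ (3 - j) *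
                      derivative (derivative (X ^ i * P))) * derivative (derivative (X ^ (j - i) * P))).eval u) / 24 +
                (∑ j ∈ Finset.range (1 + 1), ∑ i ∈ Finset.range (j + 1),
                  ((1 : ℕ).choose j : ℝ) * (j.choose i : ℝ) * 2 ^ (1 - j) *
                    ∫ u in (0 : ℝ)..1, (((Polynomial.C (1 / Δ') - X) ^ (1 - j) * (-(2 : ℝ) • (X ^ i * P))) *
                      derivative (derivative (X ^ (j - i) * P))).eval u) / 4)) / (2 * (π ^ 2 / 6) ^ 2)) := fun _ _ ↦ by
    rw [hτ]; norm_num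
  have h02 := orderZeroTwo_target_of_remainder hR₀₂
  have h22 := orderTwoTwo_target_of_poly_of_remainder 𝔎 hPoly hR₂₂
  obtain ⟨C, q₀, hC⟩ := diagPart_asymp_of_selbergOrderAsymptotics_le hΔ 2 τ t00
    (fun i j hi hj hij h00 P' hP' Δ'' h1' h2' ↦ by
      interval_cases i <;> interval_cases j
      · exact (h00 ⟨rfl, rfl⟩).elim
      · exact absurd hij (by decide)
      · rw [t02]
        exact h02 P' hP' Δ'' h1' h2'
      · exact absurd hij (by decide)
      · rw [t11]
        exact orderOneOne_target hΔ P' hP' Δ'' h1' h2'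
      · exact absurd hij (by decide)
      · -- order `(2,0)` from `(0,2)` by the order symmetry
        obtain ⟨C, q₀, hC⟩ := h02 P' hP' Δ'' h1' h2'
        obtain ⟨q₁, hq₁⟩ := exists_log_qhat_ge (1 : ℝ)
        refine ⟨C, max q₀ q₁, fun q _ hq ↦ ?_⟩
        have hl1 : (1 : ℝ) ≤ Real.log (qhat q) := hq₁ q (le_trans (le_max_right _ _) hq)
        have hQ0 : 0 ≤ qhat q := by unfold qhat; positivity
        have hQ : 0 < qhat q := lt_of_le_of_ne hQ0 fun h0 ↦ by
          rw [← h0, Real.log_zero] at hl1; linarith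
        rw [t20, selbergOrder_symm 2 0 P' (qhat q ^ Δ'') ⌊qhat q ^ Δ''⌋₊ hQ, show (2 + 0 : ℕ) = 0 + 2 from rfl]
        exact hC q (le_trans (le_max_left _ _) hq)
      · exact absurd hij (by decide)
      · rw [t22]
        exact h22 P' hP' Δ'' h1' h2')
    hP hQ h1 h2
  refine ⟨C, q₀, fun q _ hq ↦ ?_⟩
  have h := hC q hq
  have key : (∑ i ∈ Finset.range (Q.natDegree + 1), ∑ j ∈ Finset.range (Q.natDegree + 1),
      Q.coeff i * Q.coeff j * (1 + (-1 : ℝ) ^ (i + j)) * τ i j Δ' P) =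
      Q.coeff 0 ^ 2 * KMV2000.secondMomentForm Δ' P 1 + 2 * Q.coeff 1 ^ 2 * τ 1 1 Δ' P +
        4 * (Q.coeff 0 * Q.coeff 2) * τ 0 2 Δ' P + 2 * Q.coeff 2 ^ 2 * τ 2 2 Δ' P := by
    have h20 : τ 2 0 Δ' P = τ 0 2 Δ' P := by rw [t20, t02]
    obtain hdeg | hdeg | hdeg : Q.natDegree = 0 ∨ Q.natDegree = 1 ∨ Q.natDegree = 2 := by omega
    · have hc1 : Q.coeff 1 = 0 := Polynomial.coeff_eq_zero_of_natDegree_lt (by omega)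
      have hc2 : Q.coeff 2 = 0 := Polynomial.coeff_eq_zero_of_natDegree_lt (by omega)
      rw [hdeg, zero_add, Finset.sum_range_one, Finset.sum_range_one, t00, hc1, hc2]
      norm_num
      ring
    · have hc2 : Q.coeff 2 = 0 := Polynomial.coeff_eq_zero_of_natDegree_lt (by omega)
      rw [hdeg]
      simp only [Finset.sum_range_succ, Finset.sum_range_zero, zero_add, add_zero, pow_zero, pow_one, t00, hc2]
      norm_num
      ring
    · rw [hdeg]
      simp only [Finset.sum_range_succ, Finset.sum_range_zero, zero_add, add_zero, pow_zero, pow_one, t00, h20]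
      norm_num
      ring
  rw [key, t11, t02, t22] at h
  exact h

end Summit.Parity.GeneralizedHardyLittlewood.Theorems.MomentsBeyondDiagonal.DiagLines

end
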